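import Summits.NavierStokesRegularity.NavierStokesRegularity.Theorems.EfficiencyFloorRigidExitTangentConeBoundedRate
import HarnessLib

/-!
# Route `EfficiencyFloor`, support `RigidExit` (stmt-25513) on the `ProductionEfficiencyDecay` ladder (stmt-22866):
# the RATE property of orbit representatives ⟹ (TC_Z) ⟹ early deficit everywhere, BY NAME

Helper file (`--supports stmt-NavierStokesRegularity-22866`; line `efficiency_floor`), assembling `…TangentConeEnstrophy`
((TC_Z) ⟹ no maximiser interval ⟹ early deficit at every slice time) with `…TangentConeBoundedRate` (orbit tangents along
representatives at rate `O(τₙ)` are infinitesimal symmetries). The single remaining input of item (i) ORBIT SELECTION is thereby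
isolated as ONE property of the normalised-maximiser set 𝓜 at constant `c`, viscosity `ν`:

  (RATE) every enstrophy-controlled pointwise tangent sequence `wₙ → m` of 𝓜 (`wₙ ∈ 𝓜`, `τₙ ↓ 0`, `Z(wₙ) → Z(m)`,
  `τₙ⁻¹(wₙ − m) → h` pointwise) has, along a subsequence, orbit representatives OVER `m` ITSELF,
  `w_(φ n) = λₙ Cₙ m(λₙ C'ₙ(· − aₙ))` (`C'ₙ Cₙ = I`, `Cₙ` inner-product preserving), whose parameter difference quotients
  `τ_(φ n)⁻¹(λₙ − 1)`, `τ_(φ n)⁻¹(Cₙ − I)`, `τ_(φ n)⁻¹(C'ₙ − I)`, `τ_(φ n)⁻¹ aₙ` CONVERGE.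

Under clause (a) of `MaximiserSetRigidity`, membership of the `wₙ` in the orbit of `m` and convergence of the parameters THEMSELVES
(`λₙ → 1`, `Cₙ → I`, `aₙ → 0`) are supplied by `…OrbitClosed`/`…ScaleClock`; (RATE) adds that they move at rate `O(τₙ)` — the
compact-stabiliser slice for the Euclidean group acting on an `H²` profile.

* `tangentCone_of_rate` — (RATE) ⟹ (TC_Z) (`TangentCone.tangent_of_boundedRate` along the subsequence).
* `no_maximiserInterval_of_rate`, `earlyDeficit_everywhere_of_rate` (BY NAME, sharp constant `c⋆`) — (RATE) ⟹ no maximiser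
  interval along any solution of the route class ⟹ the early-deficit inequality at EVERY slice time with some margin.

HONEST FRAMING: statements about a HYPOTHETICAL blow-up; (RATE), clause (a), `RigidExit`, `NearMaximiserBoundedAmplification`,
`LerayFloorGap`, `ProductionEfficiencyDecay` (stmt-22866) and Navier–Stokes regularity stay OPEN; item (ii) (uniform margin) is
untouched; no summit statement is proved. [folklore]
-/

-- the problem directory repeats the summit name (`NavierStokesRegularity/NavierStokesRegularity`)
set_option linter.dupNamespace false

noncomputable section

open Set Filter MeasureTheory Topology Function
open scoped InnerProductSpace RealInnerProductSpace ENNReal NNReal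
open Literature.Analysis.FluidPDE

namespace Summit.NavierStokesRegularity.NavierStokesRegularity.Theorems

namespace RigidExit

namespace TangentCone

open NearMaximiserBoundedAmplification

/-- **(RATE) ⟹ (TC_Z)** at constant `c`, viscosity `ν`. [folklore] -/
theorem tangentCone_of_rate {c ν : ℝ}
    (hRATE : (∀ m : EuclideanSpace ℝ (Fin 3) → EuclideanSpace ℝ (Fin 3), (((ContDiff ℝ (⊤ : ℕ∞) m ∧ VectorCalculus.IsDivFree m ∧
        (∫⁻ x, ‖iteratedFDeriv ℝ 0 m x‖ₑ ^ 2 < ⊤) ∧ (∫⁻ x, ‖iteratedFDeriv ℝ 1 m x‖ₑ ^ 2 < ⊤) ∧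
        (∫⁻ x, ‖iteratedFDeriv ℝ 2 m x‖ₑ ^ 2 < ⊤)) ∧ 0 < (∫ x, ‖curl m x‖ ^ 2) ∧
        (∫ x, ⟪curl m x, fderiv ℝ m x (curl m x)⟫_ℝ) = c * (∫ x, ‖curl m x‖ ^ 2) ^ (3 / 4 : ℝ) *
          (∫ x, frobeniusNormSq (fderiv ℝ (curl m) x)) ^ (3 / 4 : ℝ) ∧
        (∫ x, frobeniusNormSq (fderiv ℝ (curl m) x)) = 81 * c ^ 4 / (256 * ν ^ 4) * (∫ x, ‖curl m x‖ ^ 2) ^ 3)) →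
        ∀ (w : ℕ → EuclideanSpace ℝ (Fin 3) → EuclideanSpace ℝ (Fin 3)) (τ : ℕ → ℝ) (h : EuclideanSpace ℝ (Fin 3) → EuclideanSpace ℝ (Fin 3)),
          (∀ n, (((ContDiff ℝ (⊤ : ℕ∞) (w n) ∧ VectorCalculus.IsDivFree (w n) ∧
        (∫⁻ x, ‖iteratedFDeriv ℝ 0 (w n) x‖ₑ ^ 2 < ⊤) ∧ (∫⁻ x, ‖iteratedFDeriv ℝ 1 (w n) x‖ₑ ^ 2 < ⊤) ∧
        (∫⁻ x, ‖iteratedFDeriv ℝ 2 (w n) x‖ₑ ^ 2 < ⊤)) ∧ 0 < (∫ x, ‖curl (w n) x‖ ^ 2) ∧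
        (∫ x, ⟪curl (w n) x, fderiv ℝ (w n) x (curl (w n) x)⟫_ℝ) = c * (∫ x, ‖curl (w n) x‖ ^ 2) ^ (3 / 4 : ℝ) *
          (∫ x, frobeniusNormSq (fderiv ℝ (curl (w n)) x)) ^ (3 / 4 : ℝ) ∧
        (∫ x, frobeniusNormSq (fderiv ℝ (curl (w n)) x)) = 81 * c ^ 4 / (256 * ν ^ 4) * (∫ x, ‖curl (w n) x‖ ^ 2) ^ 3))) → (∀ n, 0 < τ n) → Tendsto τ atTop (𝓝 0) →
          Tendsto (fun n => ∫ x, ‖curl (w n) x‖ ^ 2) atTop (𝓝 (∫ x, ‖curl m x‖ ^ 2)) →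
          (∀ x, Tendsto (fun n => (τ n)⁻¹ • (w n x - m x)) atTop (𝓝 (h x))) →
          ∃ (φ : ℕ → ℕ) (lam : ℕ → ℝ) (C C' : ℕ → (EuclideanSpace ℝ (Fin 3) →L[ℝ] EuclideanSpace ℝ (Fin 3))) (a : ℕ → EuclideanSpace ℝ (Fin 3)) (l' : ℝ)
            (Rd Rd' : EuclideanSpace ℝ (Fin 3) →L[ℝ] EuclideanSpace ℝ (Fin 3)) (ad : EuclideanSpace ℝ (Fin 3)),
            StrictMono φ ∧ (∀ n v, C' n (C n v) = v) ∧ (∀ n (v v' : EuclideanSpace ℝ (Fin 3)), ⟪C n v, C n v'⟫_ℝ = ⟪v, v'⟫_ℝ) ∧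
            (∀ n, w (φ n) = fun x => lam n • C n (m (lam n • C' n (x - a n)))) ∧
            Tendsto (fun n => (τ (φ n))⁻¹ * (lam n - 1)) atTop (𝓝 l') ∧
            Tendsto (fun n => (τ (φ n))⁻¹ • (C n - ContinuousLinearMap.id ℝ (EuclideanSpace ℝ (Fin 3)))) atTop (𝓝 Rd) ∧
            Tendsto (fun n => (τ (φ n))⁻¹ • (C' n - ContinuousLinearMap.id ℝ (EuclideanSpace ℝ (Fin 3)))) atTop (𝓝 Rd') ∧
            Tendsto (fun n => (τ (φ n))⁻¹ • a n) atTop (𝓝 ad))) :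
    (∀ m : EuclideanSpace ℝ (Fin 3) → EuclideanSpace ℝ (Fin 3), (((ContDiff ℝ (⊤ : ℕ∞) m ∧ VectorCalculus.IsDivFree m ∧
        (∫⁻ x, ‖iteratedFDeriv ℝ 0 m x‖ₑ ^ 2 < ⊤) ∧ (∫⁻ x, ‖iteratedFDeriv ℝ 1 m x‖ₑ ^ 2 < ⊤) ∧
        (∫⁻ x, ‖iteratedFDeriv ℝ 2 m x‖ₑ ^ 2 < ⊤)) ∧ 0 < (∫ x, ‖curl m x‖ ^ 2) ∧
        (∫ x, ⟪curl m x, fderiv ℝ m x (curl m x)⟫_ℝ) = c * (∫ x, ‖curl m x‖ ^ 2) ^ (3 / 4 : ℝ) *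
          (∫ x, frobeniusNormSq (fderiv ℝ (curl m) x)) ^ (3 / 4 : ℝ) ∧
        (∫ x, frobeniusNormSq (fderiv ℝ (curl m) x)) = 81 * c ^ 4 / (256 * ν ^ 4) * (∫ x, ‖curl m x‖ ^ 2) ^ 3)) →
        ∀ h : EuclideanSpace ℝ (Fin 3) → EuclideanSpace ℝ (Fin 3),
        (∃ (w : ℕ → EuclideanSpace ℝ (Fin 3) → EuclideanSpace ℝ (Fin 3)) (τ : ℕ → ℝ),
          (∀ n, (((ContDiff ℝ (⊤ : ℕ∞) (w n) ∧ VectorCalculus.IsDivFree (w n) ∧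
        (∫⁻ x, ‖iteratedFDeriv ℝ 0 (w n) x‖ₑ ^ 2 < ⊤) ∧ (∫⁻ x, ‖iteratedFDeriv ℝ 1 (w n) x‖ₑ ^ 2 < ⊤) ∧
        (∫⁻ x, ‖iteratedFDeriv ℝ 2 (w n) x‖ₑ ^ 2 < ⊤)) ∧ 0 < (∫ x, ‖curl (w n) x‖ ^ 2) ∧
        (∫ x, ⟪curl (w n) x, fderiv ℝ (w n) x (curl (w n) x)⟫_ℝ) = c * (∫ x, ‖curl (w n) x‖ ^ 2) ^ (3 / 4 : ℝ) *
          (∫ x, frobeniusNormSq (fderiv ℝ (curl (w n)) x)) ^ (3 / 4 : ℝ) ∧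
        (∫ x, frobeniusNormSq (fderiv ℝ (curl (w n)) x)) = 81 * c ^ 4 / (256 * ν ^ 4) * (∫ x, ‖curl (w n) x‖ ^ 2) ^ 3))) ∧
          (∀ n, 0 < τ n) ∧ Tendsto τ atTop (𝓝 0) ∧
          Tendsto (fun n => ∫ x, ‖curl (w n) x‖ ^ 2) atTop (𝓝 (∫ x, ‖curl m x‖ ^ 2)) ∧
          ∀ x, Tendsto (fun n => (τ n)⁻¹ • (w n x - m x)) atTop (𝓝 (h x))) →
        ∃ (d : EuclideanSpace ℝ (Fin 3)) (W : EuclideanSpace ℝ (Fin 3) →L[ℝ] EuclideanSpace ℝ (Fin 3)) (c' : ℝ),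
          (∀ x y : EuclideanSpace ℝ (Fin 3), ⟪W x, y⟫_ℝ = -⟪x, W y⟫_ℝ) ∧
          ∀ x, h x = fderiv ℝ m x d + (fderiv ℝ m x (W x) - W (m x)) + c' • (m x + fderiv ℝ m x x)) := by
  intro m hm h hex
  obtain ⟨w, τ, hw, hτpos, hτ0, hZ, hptw⟩ := hex
  obtain ⟨φ, lam, C, C', a, l', Rd, Rd', ad, hφ, hinv, hiso, hrep, hl, hC, hC', ha⟩ :=
    hRATE m hm w τ h hw hτpos hτ0 hZ hptw
  have hmd : Differentiable ℝ m := hm.1.1.differentiable (by simp)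
  have hτ' : ∀ n, τ (φ n) ≠ 0 := fun n => (hτpos (φ n)).ne'
  have hτ'0 : Tendsto (fun n => τ (φ n)) atTop (𝓝 0) := hτ0.comp hφ.tendsto_atTop
  have hh : ∀ x, Tendsto (fun n => (τ (φ n))⁻¹ • (lam n • C n (m (lam n • C' n (x - a n))) - m x)) atTop (𝓝 (h x)) := by
    intro x
    have h1 := (hptw x).comp hφ.tendsto_atTop
    refine h1.congr fun n => ?_
    simp only [Function.comp_apply, hrep n]
  exact tangent_of_boundedRate hmd hinv hiso hτ' hτ'0 hl hC hC' ha hh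

/-- **(RATE) ⟹ no maximiser interval** (sharp constant `c⋆`), BY NAME. [folklore] -/
theorem no_maximiserInterval_of_rate :
    ∃ c : ℝ, (0 < c ∧ (∀ v : EuclideanSpace ℝ (Fin 3) → EuclideanSpace ℝ (Fin 3), (ContDiff ℝ (⊤ : ℕ∞) v ∧
      VectorCalculus.IsDivFree v ∧ (∫⁻ x, ‖iteratedFDeriv ℝ 0 v x‖ₑ ^ 2 < ⊤) ∧ (∫⁻ x, ‖iteratedFDeriv ℝ 1 v x‖ₑ ^ 2 < ⊤) ∧
      (∫⁻ x, ‖iteratedFDeriv ℝ 2 v x‖ₑ ^ 2 < ⊤)) → (∫ x, ⟪curl v x, fderiv ℝ v x (curl v x)⟫_ℝ) ≤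
      c * (∫ x, ‖curl v x‖ ^ 2) ^ (3 / 4 : ℝ) * (∫ x, frobeniusNormSq (fderiv ℝ (curl v) x)) ^ (3 / 4 : ℝ)) ∧
      ∀ c' : ℝ, (∀ w : EuclideanSpace ℝ (Fin 3) → EuclideanSpace ℝ (Fin 3), (ContDiff ℝ (⊤ : ℕ∞) w ∧
      VectorCalculus.IsDivFree w ∧ (∫⁻ x, ‖iteratedFDeriv ℝ 0 w x‖ₑ ^ 2 < ⊤) ∧ (∫⁻ x, ‖iteratedFDeriv ℝ 1 w x‖ₑ ^ 2 < ⊤) ∧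
      (∫⁻ x, ‖iteratedFDeriv ℝ 2 w x‖ₑ ^ 2 < ⊤)) → (∫ x, ⟪curl w x, fderiv ℝ w x (curl w x)⟫_ℝ) ≤
      c' * (∫ x, ‖curl w x‖ ^ 2) ^ (3 / 4 : ℝ) * (∫ x, frobeniusNormSq (fderiv ℝ (curl w) x)) ^ (3 / 4 : ℝ)) → c ≤ c') ∧
      ∀ (ν T : ℝ), 0 < ν → 0 < T →
      ∀ (u : ℝ → EuclideanSpace ℝ (Fin 3) → EuclideanSpace ℝ (Fin 3)) (p : ℝ → EuclideanSpace ℝ (Fin 3) → ℝ),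
      IsMaximalSmoothSolution ν 0 u p T → IsLerayHopfOn T ν 0 (u 0) u → HasRapidSpatialDecay (u 0) →
      (∀ m : EuclideanSpace ℝ (Fin 3) → EuclideanSpace ℝ (Fin 3), (((ContDiff ℝ (⊤ : ℕ∞) m ∧ VectorCalculus.IsDivFree m ∧
        (∫⁻ x, ‖iteratedFDeriv ℝ 0 m x‖ₑ ^ 2 < ⊤) ∧ (∫⁻ x, ‖iteratedFDeriv ℝ 1 m x‖ₑ ^ 2 < ⊤) ∧
        (∫⁻ x, ‖iteratedFDeriv ℝ 2 m x‖ₑ ^ 2 < ⊤)) ∧ 0 < (∫ x, ‖curl m x‖ ^ 2) ∧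
        (∫ x, ⟪curl m x, fderiv ℝ m x (curl m x)⟫_ℝ) = c * (∫ x, ‖curl m x‖ ^ 2) ^ (3 / 4 : ℝ) *
          (∫ x, frobeniusNormSq (fderiv ℝ (curl m) x)) ^ (3 / 4 : ℝ) ∧
        (∫ x, frobeniusNormSq (fderiv ℝ (curl m) x)) = 81 * c ^ 4 / (256 * ν ^ 4) * (∫ x, ‖curl m x‖ ^ 2) ^ 3)) →
        ∀ (w : ℕ → EuclideanSpace ℝ (Fin 3) → EuclideanSpace ℝ (Fin 3)) (τ : ℕ → ℝ) (h : EuclideanSpace ℝ (Fin 3) → EuclideanSpace ℝ (Fin 3)),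
          (∀ n, (((ContDiff ℝ (⊤ : ℕ∞) (w n) ∧ VectorCalculus.IsDivFree (w n) ∧
        (∫⁻ x, ‖iteratedFDeriv ℝ 0 (w n) x‖ₑ ^ 2 < ⊤) ∧ (∫⁻ x, ‖iteratedFDeriv ℝ 1 (w n) x‖ₑ ^ 2 < ⊤) ∧
        (∫⁻ x, ‖iteratedFDeriv ℝ 2 (w n) x‖ₑ ^ 2 < ⊤)) ∧ 0 < (∫ x, ‖curl (w n) x‖ ^ 2) ∧
        (∫ x, ⟪curl (w n) x, fderiv ℝ (w n) x (curl (w n) x)⟫_ℝ) = c * (∫ x, ‖curl (w n) x‖ ^ 2) ^ (3 / 4 : ℝ) *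
          (∫ x, frobeniusNormSq (fderiv ℝ (curl (w n)) x)) ^ (3 / 4 : ℝ) ∧
        (∫ x, frobeniusNormSq (fderiv ℝ (curl (w n)) x)) = 81 * c ^ 4 / (256 * ν ^ 4) * (∫ x, ‖curl (w n) x‖ ^ 2) ^ 3))) → (∀ n, 0 < τ n) → Tendsto τ atTop (𝓝 0) →
          Tendsto (fun n => ∫ x, ‖curl (w n) x‖ ^ 2) atTop (𝓝 (∫ x, ‖curl m x‖ ^ 2)) →
          (∀ x, Tendsto (fun n => (τ n)⁻¹ • (w n x - m x)) atTop (𝓝 (h x))) →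
          ∃ (φ : ℕ → ℕ) (lam : ℕ → ℝ) (C C' : ℕ → (EuclideanSpace ℝ (Fin 3) →L[ℝ] EuclideanSpace ℝ (Fin 3))) (a : ℕ → EuclideanSpace ℝ (Fin 3)) (l' : ℝ)
            (Rd Rd' : EuclideanSpace ℝ (Fin 3) →L[ℝ] EuclideanSpace ℝ (Fin 3)) (ad : EuclideanSpace ℝ (Fin 3)),
            StrictMono φ ∧ (∀ n v, C' n (C n v) = v) ∧ (∀ n (v v' : EuclideanSpace ℝ (Fin 3)), ⟪C n v, C n v'⟫_ℝ = ⟪v, v'⟫_ℝ) ∧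
            (∀ n, w (φ n) = fun x => lam n • C n (m (lam n • C' n (x - a n)))) ∧
            Tendsto (fun n => (τ (φ n))⁻¹ * (lam n - 1)) atTop (𝓝 l') ∧
            Tendsto (fun n => (τ (φ n))⁻¹ • (C n - ContinuousLinearMap.id ℝ (EuclideanSpace ℝ (Fin 3)))) atTop (𝓝 Rd) ∧
            Tendsto (fun n => (τ (φ n))⁻¹ • (C' n - ContinuousLinearMap.id ℝ (EuclideanSpace ℝ (Fin 3)))) atTop (𝓝 Rd') ∧
            Tendsto (fun n => (τ (φ n))⁻¹ • a n) atTop (𝓝 ad)) →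
      ∀ s s₁ : ℝ, 0 < s → s < s₁ → s₁ < T → ¬ (∀ σ ∈ Icc s s₁, (((ContDiff ℝ (⊤ : ℕ∞) (u σ) ∧ VectorCalculus.IsDivFree (u σ) ∧
        (∫⁻ x, ‖iteratedFDeriv ℝ 0 (u σ) x‖ₑ ^ 2 < ⊤) ∧ (∫⁻ x, ‖iteratedFDeriv ℝ 1 (u σ) x‖ₑ ^ 2 < ⊤) ∧
        (∫⁻ x, ‖iteratedFDeriv ℝ 2 (u σ) x‖ₑ ^ 2 < ⊤)) ∧ 0 < (∫ x, ‖curl (u σ) x‖ ^ 2) ∧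
        (∫ x, ⟪curl (u σ) x, fderiv ℝ (u σ) x (curl (u σ) x)⟫_ℝ) = c * (∫ x, ‖curl (u σ) x‖ ^ 2) ^ (3 / 4 : ℝ) *
          (∫ x, frobeniusNormSq (fderiv ℝ (curl (u σ)) x)) ^ (3 / 4 : ℝ) ∧
        (∫ x, frobeniusNormSq (fderiv ℝ (curl (u σ)) x)) = 81 * c ^ 4 / (256 * ν ^ 4) * (∫ x, ‖curl (u σ) x‖ ^ 2) ^ 3))) := by
  obtain ⟨c, hsharp, hno⟩ := no_maximiserInterval_of_tangentCone_enstrophy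
  exact ⟨c, hsharp, fun ν T hν hT u p hmax hLH hdec hRATE => hno ν T hν hT u p hmax hLH hdec (tangentCone_of_rate hRATE)⟩

/-- **(RATE) ⟹ the early-deficit inequality at EVERY slice time** (sharp constant `c⋆`, every `0 < η < 1`, some margin `θ > 0`),
BY NAME. [folklore] -/
theorem earlyDeficit_everywhere_of_rate :
    ∃ c : ℝ, (0 < c ∧ (∀ v : EuclideanSpace ℝ (Fin 3) → EuclideanSpace ℝ (Fin 3), (ContDiff ℝ (⊤ : ℕ∞) v ∧
      VectorCalculus.IsDivFree v ∧ (∫⁻ x, ‖iteratedFDeriv ℝ 0 v x‖ₑ ^ 2 < ⊤) ∧ (∫⁻ x, ‖iteratedFDeriv ℝ 1 v x‖ₑ ^ 2 < ⊤) ∧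
      (∫⁻ x, ‖iteratedFDeriv ℝ 2 v x‖ₑ ^ 2 < ⊤)) → (∫ x, ⟪curl v x, fderiv ℝ v x (curl v x)⟫_ℝ) ≤
      c * (∫ x, ‖curl v x‖ ^ 2) ^ (3 / 4 : ℝ) * (∫ x, frobeniusNormSq (fderiv ℝ (curl v) x)) ^ (3 / 4 : ℝ)) ∧
      ∀ c' : ℝ, (∀ w : EuclideanSpace ℝ (Fin 3) → EuclideanSpace ℝ (Fin 3), (ContDiff ℝ (⊤ : ℕ∞) w ∧
      VectorCalculus.IsDivFree w ∧ (∫⁻ x, ‖iteratedFDeriv ℝ 0 w x‖ₑ ^ 2 < ⊤) ∧ (∫⁻ x, ‖iteratedFDeriv ℝ 1 w x‖ₑ ^ 2 < ⊤) ∧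
      (∫⁻ x, ‖iteratedFDeriv ℝ 2 w x‖ₑ ^ 2 < ⊤)) → (∫ x, ⟪curl w x, fderiv ℝ w x (curl w x)⟫_ℝ) ≤
      c' * (∫ x, ‖curl w x‖ ^ 2) ^ (3 / 4 : ℝ) * (∫ x, frobeniusNormSq (fderiv ℝ (curl w) x)) ^ (3 / 4 : ℝ)) → c ≤ c') ∧
      ∀ η : ℝ, 0 < η → η < 1 → ∀ (ν T : ℝ), 0 < ν → 0 < T →
      ∀ (u : ℝ → EuclideanSpace ℝ (Fin 3) → EuclideanSpace ℝ (Fin 3)) (p : ℝ → EuclideanSpace ℝ (Fin 3) → ℝ),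
      IsMaximalSmoothSolution ν 0 u p T → IsLerayHopfOn T ν 0 (u 0) u → HasRapidSpatialDecay (u 0) →
      (∀ m : EuclideanSpace ℝ (Fin 3) → EuclideanSpace ℝ (Fin 3), (((ContDiff ℝ (⊤ : ℕ∞) m ∧ VectorCalculus.IsDivFree m ∧
        (∫⁻ x, ‖iteratedFDeriv ℝ 0 m x‖ₑ ^ 2 < ⊤) ∧ (∫⁻ x, ‖iteratedFDeriv ℝ 1 m x‖ₑ ^ 2 < ⊤) ∧
        (∫⁻ x, ‖iteratedFDeriv ℝ 2 m x‖ₑ ^ 2 < ⊤)) ∧ 0 < (∫ x, ‖curl m x‖ ^ 2) ∧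
        (∫ x, ⟪curl m x, fderiv ℝ m x (curl m x)⟫_ℝ) = c * (∫ x, ‖curl m x‖ ^ 2) ^ (3 / 4 : ℝ) *
          (∫ x, frobeniusNormSq (fderiv ℝ (curl m) x)) ^ (3 / 4 : ℝ) ∧
        (∫ x, frobeniusNormSq (fderiv ℝ (curl m) x)) = 81 * c ^ 4 / (256 * ν ^ 4) * (∫ x, ‖curl m x‖ ^ 2) ^ 3)) →
        ∀ (w : ℕ → EuclideanSpace ℝ (Fin 3) → EuclideanSpace ℝ (Fin 3)) (τ : ℕ → ℝ) (h : EuclideanSpace ℝ (Fin 3) → EuclideanSpace ℝ (Fin 3)),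
          (∀ n, (((ContDiff ℝ (⊤ : ℕ∞) (w n) ∧ VectorCalculus.IsDivFree (w n) ∧
        (∫⁻ x, ‖iteratedFDeriv ℝ 0 (w n) x‖ₑ ^ 2 < ⊤) ∧ (∫⁻ x, ‖iteratedFDeriv ℝ 1 (w n) x‖ₑ ^ 2 < ⊤) ∧
        (∫⁻ x, ‖iteratedFDeriv ℝ 2 (w n) x‖ₑ ^ 2 < ⊤)) ∧ 0 < (∫ x, ‖curl (w n) x‖ ^ 2) ∧
        (∫ x, ⟪curl (w n) x, fderiv ℝ (w n) x (curl (w n) x)⟫_ℝ) = c * (∫ x, ‖curl (w n) x‖ ^ 2) ^ (3 / 4 : ℝ) *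
          (∫ x, frobeniusNormSq (fderiv ℝ (curl (w n)) x)) ^ (3 / 4 : ℝ) ∧
        (∫ x, frobeniusNormSq (fderiv ℝ (curl (w n)) x)) = 81 * c ^ 4 / (256 * ν ^ 4) * (∫ x, ‖curl (w n) x‖ ^ 2) ^ 3))) → (∀ n, 0 < τ n) → Tendsto τ atTop (𝓝 0) →
          Tendsto (fun n => ∫ x, ‖curl (w n) x‖ ^ 2) atTop (𝓝 (∫ x, ‖curl m x‖ ^ 2)) →
          (∀ x, Tendsto (fun n => (τ n)⁻¹ • (w n x - m x)) atTop (𝓝 (h x))) →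
          ∃ (φ : ℕ → ℕ) (lam : ℕ → ℝ) (C C' : ℕ → (EuclideanSpace ℝ (Fin 3) →L[ℝ] EuclideanSpace ℝ (Fin 3))) (a : ℕ → EuclideanSpace ℝ (Fin 3)) (l' : ℝ)
            (Rd Rd' : EuclideanSpace ℝ (Fin 3) →L[ℝ] EuclideanSpace ℝ (Fin 3)) (ad : EuclideanSpace ℝ (Fin 3)),
            StrictMono φ ∧ (∀ n v, C' n (C n v) = v) ∧ (∀ n (v v' : EuclideanSpace ℝ (Fin 3)), ⟪C n v, C n v'⟫_ℝ = ⟪v, v'⟫_ℝ) ∧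
            (∀ n, w (φ n) = fun x => lam n • C n (m (lam n • C' n (x - a n)))) ∧
            Tendsto (fun n => (τ (φ n))⁻¹ * (lam n - 1)) atTop (𝓝 l') ∧
            Tendsto (fun n => (τ (φ n))⁻¹ • (C n - ContinuousLinearMap.id ℝ (EuclideanSpace ℝ (Fin 3)))) atTop (𝓝 Rd) ∧
            Tendsto (fun n => (τ (φ n))⁻¹ • (C' n - ContinuousLinearMap.id ℝ (EuclideanSpace ℝ (Fin 3)))) atTop (𝓝 Rd') ∧
            Tendsto (fun n => (τ (φ n))⁻¹ • a n) atTop (𝓝 ad)) →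
      ∀ s ∈ Ioo 0 T, s + η * (64 * ν ^ 3 / (27 * c ^ 4) * (∫ x, ‖curl (u s) x‖ ^ 2)⁻¹ ^ 2) < T →
        ∃ θ : ℝ, 0 < θ ∧ (1 - η + 2 * θ) * (∫ x, ‖curl (u s) x‖ ^ 2)⁻¹ ^ 2 ≤
          (∫ x, ‖curl (u (s + η * (64 * ν ^ 3 / (27 * c ^ 4) * (∫ x, ‖curl (u s) x‖ ^ 2)⁻¹ ^ 2))) x‖ ^ 2)⁻¹ ^ 2 := by
  obtain ⟨c, hsharp, hED⟩ := earlyDeficit_everywhere_of_tangentCone_enstrophy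
  exact ⟨c, hsharp, fun η hη0 hη1 ν T hν hT u p hmax hLH hdec hRATE =>
    hED η hη0 hη1 ν T hν hT u p hmax hLH hdec (tangentCone_of_rate hRATE)⟩

end TangentCone

end RigidExit

end Summit.NavierStokesRegularity.NavierStokesRegularity.Theorems
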